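import Literature.AlgebraicGeometry.Motives.AlgPointsProofs
import Literature.NumberTheory.Transcendental.AnalytificationClosure
import Mathlib.Topology.Baire.LocallyCompactRegular
import HarnessLib

/-!
# Very general complex points: countably many proper Zariski-closed subsets do not cover `X(ℂ)`

Topic `Literature/AlgebraicGeometry/Motives`. Theorems only (no definition, no named fact; D-0026).

The standard "very general point" device of complex algebraic geometry: for an IRREDUCIBLE
`ℂ`-scheme `X` locally of finite type and separated, the complex points lying outside a countable
union `⋃ⱼ Cⱼ` of PROPER Zariski-closed subsets `Cⱼ ⊊ X` form a dense subset of `X(ℂ)` (analytic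
topology); in particular every non-empty analytic open subset `W ⊆ X(ℂ)` contains such a point. In
print: C. Voisin, *Hodge Theory and Complex Algebraic Geometry II* (2003), §3.3.1 (countability of
the components of relative Hilbert schemes, "a general point"); D. Arapura, *Hodge cycles and the
Leray filtration*, Pacific J. Math. 319 (2022), proof of Cor. 1.5 ("Since `C` is a countable union of
proper subvarieties `U - C ≠ ∅`. Choose `y ∈ U - C`."). The tree had the curve case only, by
counting (`ComplexPoints.not_countable_of_smoothOfRelativeDimension`: countably many POINTS do not
exhaust an uncountable `S(ℂ)`); over a base of dimension `≥ 2` the bad sets are positive-dimensional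
and the printed "(Baire)" is needed. Proof, on the tree's carriers:

* `X(ℂ)` is locally compact (`Motives.locallyCompactSpace_algPoints_holds`, Conrad Prop. 3.1) and
  Hausdorff (`ComplexPoints.t2Space_of_isSeparated`, SGA1 XII 3.1), hence a Baire space (Mathlib,
  `BaireSpace.of_t2Space_locallyCompactSpace`): `ComplexPoints.baireSpace`;
* for `C ⊊ X` closed, `X ∖ C` is a dense open of the irreducible `X`, so `(X ∖ C)(ℂ)` is dense in
  `X(ℂ)` (Serre, GAGA Prop. 5 = SGA1 XII Cor. 2.3, the tree's PROVED
  `ComplexPoints.dense_setOf_pt_mem` with `ComplexPoints.closure_setOf_pt_mem_holds`) and open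
  (`AlgPoints.isOpen_setOf_pt_mem`): `ComplexPoints.dense_setOf_pt_not_mem`,
  `ComplexPoints.interior_setOf_pt_mem_eq_empty`;
* Baire: a countable intersection of dense opens is dense — `ComplexPoints.dense_setOf_forall_pt_not_mem`
  (indexed family), `ComplexPoints.dense_setOf_forall_mem_pt_not_mem` (countable set of closed
  subsets), and the pointed forms `ComplexPoints.exists_mem_forall_pt_not_mem` /
  `ComplexPoints.exists_forall_pt_not_mem` ("choose `y ∈ U - C`").

## References

* [VoisinHodgeII2003] C. Voisin, Hodge Theory and Complex Algebraic Geometry II (CUP 2003), §3.3.1.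
* [Arapura2022] D. Arapura, Hodge cycles and the Leray filtration, Pacific J. Math. 319 (2022),
  proof of Cor. 1.5 (p. 5 of arXiv:2103.05038).
* [SerreGAGA1956] J.-P. Serre, Géométrie algébrique et géométrie analytique, Ann. Inst. Fourier 6
  (1956), §2 n°7 Prop. 5.
* [SGA1] A. Grothendieck, SGA 1, Exp. XII Prop. 2.2, Cor. 2.3, Prop. 3.1.
* [ConradAdelicPoints2012] B. Conrad, Weil and Grothendieck approaches to adelic points, Enseign.
  Math. 58 (2012), Prop. 3.1.
-/

noncomputable section

open CategoryTheory AlgebraicGeometry Set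
open _root_.Topology _root_.TopologicalSpace

namespace Literature.AlgebraicGeometry.Motives.ComplexPoints

variable (X : SchemeOver ℂ)

/-- **`X(ℂ)` is a Baire space** for `X` separated and locally of finite type over `ℂ`: it is locally
compact (Conrad, Prop. 3.1: the tree's `locallyCompactSpace_algPoints_holds`) and Hausdorff
(SGA1 XII 3.1: `t2Space_of_isSeparated`), and locally compact Hausdorff spaces are Baire.
[cite: ConradAdelicPoints2012, Prop. 3.1] [cite: SGA1, Exp. XII Prop. 3.1] -/
theorem baireSpace [IsSeparated X.hom] [LocallyOfFiniteType X.hom] : BaireSpace (ComplexPoints X) := by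
  haveI : T2Space (ComplexPoints X) := t2Space_of_isSeparated X
  haveI : LocallyCompactSpace (ComplexPoints X) := locallyCompactSpace_algPoints_holds X ℂ
  exact BaireSpace.of_t2Space_locallyCompactSpace

variable {X}

/-- **The complex points off a proper Zariski-closed subset of an irreducible `X` are dense and
open in `X(ℂ)`** (`X` locally of finite type over `ℂ`): `X ∖ C` is a non-empty, hence dense, open
subset of the irreducible `X`, and Zariski-dense opens have dense complex points (Serre, GAGA
Prop. 5; SGA1 XII Cor. 2.3). [cite: SerreGAGA1956, §2 n°7 Prop. 5] [cite: SGA1, Exp. XII Cor. 2.3] -/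
theorem dense_setOf_pt_not_mem [LocallyOfFiniteType X.hom] [IrreducibleSpace X.left] {C : Set X.left}
    (hC : IsClosed C) (hCne : C ≠ univ) : Dense {P : ComplexPoints X | P.pt ∉ C} := by
  let U : X.left.Opens := ⟨Cᶜ, hC.isOpen_compl⟩
  have hUne : (U : Set X.left).Nonempty := nonempty_compl.2 hCne
  have hUd : Dense (U : Set X.left) := U.isOpen.dense hUne
  exact dense_setOf_pt_mem X (closure_setOf_pt_mem_holds (X := X)) U hUd

/-- Hence **the complex points of a proper Zariski-closed subset of an irreducible `X` have empty
interior** in `X(ℂ)` (they miss the dense set `(X ∖ C)(ℂ)`). [cite: SerreGAGA1956, §2 n°7 Prop. 5] -/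
theorem interior_setOf_pt_mem_eq_empty [LocallyOfFiniteType X.hom] [IrreducibleSpace X.left]
    {C : Set X.left} (hC : IsClosed C) (hCne : C ≠ univ) :
    interior {P : ComplexPoints X | P.pt ∈ C} = ∅ := by
  have hd := dense_setOf_pt_not_mem (X := X) hC hCne
  have hcompl : {P : ComplexPoints X | P.pt ∉ C} = {P : ComplexPoints X | P.pt ∈ C}ᶜ := rfl
  rw [hcompl] at hd
  exact interior_eq_empty_iff_dense_compl.2 hd

/-- **Very general complex points are dense (indexed form).** For `X` irreducible, separated and
locally of finite type over `ℂ` and countably many proper Zariski-closed subsets `C i ⊊ X`, the set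
of complex points lying in none of the `C i` is dense in `X(ℂ)`: Baire's theorem for the dense opens
`(X ∖ C i)(ℂ)`. [cite: VoisinHodgeII2003, §3.3.1] [cite: Arapura2022, proof of Cor. 1.5] -/
theorem dense_setOf_forall_pt_not_mem [IsSeparated X.hom] [LocallyOfFiniteType X.hom]
    [IrreducibleSpace X.left] {ι : Sort*} [Countable ι] {C : ι → Set X.left}
    (hC : ∀ i, IsClosed (C i)) (hCne : ∀ i, C i ≠ univ) :
    Dense {P : ComplexPoints X | ∀ i, P.pt ∉ C i} := by
  haveI := baireSpace X
  have hopen : ∀ i, IsOpen {P : ComplexPoints X | P.pt ∉ C i} := fun i =>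
    AlgPoints.isOpen_setOf_pt_mem (X := X) (L := ℂ) ⟨(C i)ᶜ, (hC i).isOpen_compl⟩
  have hdense : ∀ i, Dense {P : ComplexPoints X | P.pt ∉ C i} := fun i =>
    dense_setOf_pt_not_mem (hC i) (hCne i)
  have h := dense_iInter_of_isOpen hopen hdense
  have heq : (⋂ i, {P : ComplexPoints X | P.pt ∉ C i}) = {P | ∀ i, P.pt ∉ C i} := by
    ext P
    simp
  rwa [heq] at h

/-- **Very general complex points are dense (set form).** For a countable set `𝒞` of proper
Zariski-closed subsets of the irreducible `X` (separated, locally of finite type over `ℂ`), the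
complex points outside every member of `𝒞` are dense in `X(ℂ)`.
[cite: VoisinHodgeII2003, §3.3.1] [cite: Arapura2022, proof of Cor. 1.5] -/
theorem dense_setOf_forall_mem_pt_not_mem [IsSeparated X.hom] [LocallyOfFiniteType X.hom]
    [IrreducibleSpace X.left] {𝒞 : Set (Set X.left)} (h𝒞 : 𝒞.Countable)
    (hC : ∀ C ∈ 𝒞, IsClosed C) (hCne : ∀ C ∈ 𝒞, C ≠ univ) :
    Dense {P : ComplexPoints X | ∀ C ∈ 𝒞, P.pt ∉ C} := by
  haveI : Countable 𝒞 := h𝒞.to_subtype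
  have h := dense_setOf_forall_pt_not_mem (X := X) (ι := 𝒞) (C := fun C => (C : Set X.left))
    (fun C => hC C C.2) (fun C => hCne C C.2)
  have heq : {P : ComplexPoints X | ∀ C : 𝒞, P.pt ∉ (C : Set X.left)} =
      {P | ∀ C ∈ 𝒞, P.pt ∉ C} := by
    ext P
    simp only [mem_setOf_eq, Subtype.forall]
  rwa [heq] at h

/-- **"Choose `y ∈ U - C`" inside a prescribed analytic open set.** For `X` irreducible, separated,
locally of finite type over `ℂ`, countably many proper Zariski-closed `C i ⊊ X` and a non-empty open
`W ⊆ X(ℂ)` (analytic topology), some complex point of `W` lies in none of the `C i`.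
[cite: Arapura2022, proof of Cor. 1.5] [cite: VoisinHodgeII2003, §3.3.1] -/
theorem exists_mem_forall_pt_not_mem [IsSeparated X.hom] [LocallyOfFiniteType X.hom]
    [IrreducibleSpace X.left] {ι : Sort*} [Countable ι] {C : ι → Set X.left}
    (hC : ∀ i, IsClosed (C i)) (hCne : ∀ i, C i ≠ univ) {W : Set (ComplexPoints X)} (hW : IsOpen W)
    (hWne : W.Nonempty) : ∃ P ∈ W, ∀ i, P.pt ∉ C i := by
  obtain ⟨P, hPW, hP⟩ := (dense_setOf_forall_pt_not_mem hC hCne).inter_open_nonempty W hW hWne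
  exact ⟨P, hPW, hP⟩

/-- **Very general complex points exist**: an irreducible, separated `ℂ`-scheme locally of finite
type with a complex point has a complex point outside any countable family of proper Zariski-closed
subsets. [cite: Arapura2022, proof of Cor. 1.5] [cite: VoisinHodgeII2003, §3.3.1] -/
theorem exists_forall_pt_not_mem [IsSeparated X.hom] [LocallyOfFiniteType X.hom]
    [IrreducibleSpace X.left] [Nonempty (ComplexPoints X)] {ι : Sort*} [Countable ι]
    {C : ι → Set X.left} (hC : ∀ i, IsClosed (C i)) (hCne : ∀ i, C i ≠ univ) :
    ∃ P : ComplexPoints X, ∀ i, P.pt ∉ C i := by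
  obtain ⟨P, -, hP⟩ := exists_mem_forall_pt_not_mem hC hCne isOpen_univ univ_nonempty
  exact ⟨P, hP⟩

/-- The same inside the complex points of a non-empty Zariski-open `U ⊆ X` and a prescribed analytic
open `W` meeting `U(ℂ)`: a very general point of `U` in `W`. (The form used with `U` the smooth
locus of a family and `W` an open condition on fibre classes.)
[cite: Arapura2022, proof of Cor. 1.5] -/
theorem exists_mem_mem_forall_pt_not_mem [IsSeparated X.hom] [LocallyOfFiniteType X.hom]
    [IrreducibleSpace X.left] {ι : Sort*} [Countable ι] {C : ι → Set X.left}
    (hC : ∀ i, IsClosed (C i)) (hCne : ∀ i, C i ≠ univ) (U : X.left.Opens)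
    {W : Set (ComplexPoints X)} (hW : IsOpen W) (hWU : ∃ P ∈ W, P.pt ∈ U) :
    ∃ P ∈ W, P.pt ∈ U ∧ ∀ i, P.pt ∉ C i := by
  have hopen : IsOpen (W ∩ {P : ComplexPoints X | P.pt ∈ U}) :=
    hW.inter (AlgPoints.isOpen_setOf_pt_mem (X := X) (L := ℂ) U)
  obtain ⟨P, hPW, hPU⟩ := hWU
  obtain ⟨Q, ⟨hQW, hQU⟩, hQ⟩ := exists_mem_forall_pt_not_mem hC hCne hopen ⟨P, hPW, hPU⟩
  exact ⟨Q, hQW, hQU, hQ⟩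

end Literature.AlgebraicGeometry.Motives.ComplexPoints

end
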